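import Literature.MeasureTheory.Group.GL2ZFundamentalDomain
import Literature.NumberTheory.EllipticCurves.BinaryQuarticOneParameterSubgroups
import Literature.NumberTheory.EllipticCurves.BinaryQuarticRealStabilizerProofs
import Mathlib.Analysis.SpecialFunctions.Integrals.Basic
import HarnessLib

/-!
# The averaging set `G₀` and the structure of `{h : h⁻¹ · x₀ ∈ G₀⁻¹ · L}` (Bhargava–Shankar §2.3)

Topic `Literature/NumberTheory/EllipticCurves`; uses `Literature/MeasureTheory/Group/SL2IwasawaHaar.lean`
(the Haar measure `haarSL2pm` of `SL₂^±(ℝ)`, coordinate sets, arcs) and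
`BinaryQuarticOneParameterSubgroups.lean` (`ñ(x) a(√y) k(θ) = iwasawaGinv x y θ`), and the real
stabilizer theory of `BinaryQuarticRealStabilizer(Proofs).lean` (Lemma 2.2 of Bhargava–Shankar).
Everything here is PROVED (no named facts).

In the averaging method of Bhargava–Shankar (Ann. of Math. 181 (2015), §2.3 of
`arXiv:1006.1002v2`, eqs. (5)–(7)) one integrates the number of lattice points of `g G₀ L` over
`g` in a fundamental domain, and unfolds: for a fixed `x` with `x = g_j h x_L` "for finitely many
`g_j`", `∫_{G₀} #{g ∈ F : x = g h x_L} dh = Σ_j ∫_{G₀ ∩ F⁻¹ g_j} dh`. This file provides the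
group-theoretic heart of that step for a *small* averaging set (no `K`-invariance is needed):

* `G0 = {ñ(x) a(√y) k(θ) : |x| < δ₀, |y − 1| < δ₀, θ ∈ [−δ₀, δ₀)}`, `δ₀ = 1/10`
  (`mem_G0_iff`), with entries within `1/4` of those of `1` (`entries_of_mem_G0`), so that
  `h h'⁻¹` has diagonal entries `≥ 1/2` for `h, h' ∈ G₀` (`diag_pos_of_mem_G0`); its Haar measure
  `μ(G₀) = 2δ₀ (1/(1−δ₀) − 1/(1+δ₀)) · 2δ₀ ∈ (0, ∞)` (`haarSL2pm_G0`);
* real stabilizers of forms with `Δ ≠ 0` consist of `±1` and trace-zero elements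
  (`scalar_or_trace_zero_of_mem_substStabilizer`), hence **rigidity**: `σ h = σ' h'` with
  `σ, σ'` in a stabilizer and `h, h' ∈ G₀` forces `σ = σ'`, `h = h'` (`eq_of_mul_eq_mul`);
* the averaging region `avgSet 𝓛 = {h'⁻¹ · ℓ : h' ∈ G₀, ℓ ∈ 𝓛}` and **the structure theorem**
  (`subst_inv_mem_avgSet_iff`): if `𝓛` has at most one form with given invariants and
  `x₀ = g₀ · ℓ₀` (`ℓ₀ ∈ 𝓛`, `Δ(ℓ₀) ≠ 0`, `det g₀ = ±1`), then for `det h = ±1`,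
  `h⁻¹ · x₀ ∈ avgSet 𝓛 ↔ h ∈ ⋃_{σ ∈ Stab(ℓ₀)} g₀ σ G₀`;
* **its measure**: the translates `g₀ σ G₀` are pairwise disjoint of measure `μ(G₀)` each, so the
  union over a finite set `S` of stabilizer elements has measure `|S| μ(G₀)`
  (`haarSL2pm_biUnion_translates`; with Lemma 2.2, `|Stab| = 8` or `4`).

## References

* M. Bhargava, A. Shankar, Ann. of Math. (2) 181 (2015) 191–242, §2.3, eqs. (5)–(7)
  (arXiv:1006.1002v2 numbering). [cite: BhargavaShankarAnnals2015, §2.3 (averaging; eqs. (5)–(7); arXiv:1006.1002v2 numbering)]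
-/

noncomputable section

open Real MeasureTheory Matrix Complex
open scoped MatrixGroups UpperHalfPlane

namespace Literature.NumberTheory.EllipticCurves

namespace BinaryQuartic

open Literature.MeasureTheory.Group

attribute [local instance] Literature.MeasureTheory.Group.fact_two_pi_pos

/-! ## The averaging set `G₀` -/

/-- The size `δ₀ = 1/10` of the averaging box. [folklore] -/
def δ₀ : ℝ := 1 / 10

/-- The rectangle `{|Re w| < δ₀, |Im w − 1| < δ₀}` around `i`. [folklore] -/
def rect0 : Set ℂ := {w | |w.re| < δ₀ ∧ |w.im - 1| < δ₀}

/-- **The averaging set** `G₀ = {ñ(x) ã(y) k(θ) : |x| < δ₀, |y − 1| < δ₀, θ ∈ [−δ₀, δ₀)}`, a small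
box around `1 ∈ SL₂(ℝ)` (Bhargava–Shankar's compact `G₀ ⊂ G`, §2.3; here without
`K`-invariance, which the unfolding below does not need). [cite: BhargavaShankarAnnals2015, §2.3 (the set G₀; arXiv:1006.1002v2 numbering)] -/
def G0 : Set (Matrix (Fin 2) (Fin 2) ℝ) := coordSet rect0 (arc (-δ₀) δ₀)

/-- `δ₀ > 0`. [folklore] -/
theorem δ₀_pos : 0 < δ₀ := by norm_num [δ₀]

/-- `rect0` is measurable. [folklore] -/
theorem measurableSet_rect0 : MeasurableSet rect0 := by
  unfold rect0
  exact (measurableSet_lt continuous_re.measurable.abs measurable_const).inter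
    (measurableSet_lt ((continuous_im.sub continuous_const).measurable.abs) measurable_const)

/-- `rect0 ⊆ {Im > 0}`. [folklore] -/
theorem rect0_subset : rect0 ⊆ {w : ℂ | 0 < w.im} := by
  intro w hw; have := (abs_lt.1 hw.2).1; simp only [Set.mem_setOf_eq]; norm_num [δ₀] at this ⊢; linarith

/-- **The Iwasawa map of the Haar file in terms of the one-parameter subgroups**:
`s(x + iy) k(θ) = ñ(x) a(√y) k(θ)`. [folklore] -/
theorem iwasawa_eq_iwasawaGinv (x : ℝ) {y : ℝ} (hy : 0 < y) (θ : ℝ) :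
    iwasawa (⟨⟨x, y⟩, hy⟩, (θ : AddCircle (2 * π))) = iwasawaGinv x y θ := by
  rw [iwasawa, iwasawaGinv, upperShear, diagTorus, rotR, sMat, rotMat, cosA_coe, sinA_coe]
  ext i j
  fin_cases i <;> fin_cases j <;>
    simp [Matrix.mul_apply, Fin.sum_univ_two, UpperHalfPlane.im, UpperHalfPlane.re, div_eq_mul_inv]

/-- **Coordinates on `G₀`**: `g ∈ G₀` iff `g = ñ(x) a(√y) k(θ)` with `|x| < δ₀`, `|y − 1| < δ₀`,
`θ ∈ [−δ₀, δ₀)`. [folklore] -/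
theorem mem_G0_iff {g : Matrix (Fin 2) (Fin 2) ℝ} :
    g ∈ G0 ↔ ∃ x y θ : ℝ, |x| < δ₀ ∧ |y - 1| < δ₀ ∧ θ ∈ Set.Ico (-δ₀) δ₀ ∧ g = iwasawaGinv x y θ := by
  constructor
  · intro hg
    obtain ⟨hdet, hrect, θ', hθ', hθ⟩ := hg
    have hy : 0 < yOf g := by
      have := rect0_subset hrect; simpa using this
    refine ⟨xOf g, yOf g, θ', hrect.1, hrect.2, hθ', ?_⟩
    set G : SL(2, ℝ) := ⟨g, hdet⟩ with hG
    have hdec := eq_iwasawa G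
    have hz : (G • UpperHalfPlane.I : ℍ) = ⟨⟨xOf g, yOf g⟩, hy⟩ := by
      apply UpperHalfPlane.ext
      rw [coe_smul_I_eq]
    change g = iwasawa _ at hdec
    rw [hz, show angleOf (G : Matrix (Fin 2) (Fin 2) ℝ) = angleOf g from rfl,
      ← hθ, iwasawa_eq_iwasawaGinv] at hdec
    exact hdec
  · rintro ⟨x, y, θ, hx, hy, hθ, rfl⟩
    have hy0 : 0 < y := by have := (abs_lt.1 hy).1; norm_num [δ₀] at this ⊢; linarith
    rw [← iwasawa_eq_iwasawaGinv x hy0 θ]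
    refine ⟨det_iwasawa _, ?_, ⟨θ, hθ, ?_⟩⟩
    · rw [xOf_iwasawa, yOf_iwasawa]; exact ⟨hx, hy⟩
    · rw [angleOf_iwasawa]

/-! ## Entries of elements of `G₀` are close to those of `1` -/

/-- Bounds for `√y` and `1/√y` for `|y − 1| < 1/10`. [folklore] -/
theorem sqrt_bounds {y : ℝ} (hy : |y - 1| < δ₀) :
    9 / 10 < Real.sqrt y ∧ Real.sqrt y < 11 / 10 ∧ 10 / 11 < (Real.sqrt y)⁻¹ ∧ (Real.sqrt y)⁻¹ < 10 / 9 := by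
  have h := abs_lt.1 hy
  norm_num [δ₀] at h
  have hy0 : 0 < y := by linarith
  have hs : 0 < Real.sqrt y := Real.sqrt_pos.2 hy0
  have hsq : Real.sqrt y ^ 2 = y := Real.sq_sqrt hy0.le
  have h1 : 9 / 10 < Real.sqrt y := by nlinarith
  have h2 : Real.sqrt y < 11 / 10 := by nlinarith
  refine ⟨h1, h2, ?_, ?_⟩
  · rw [lt_inv_comm₀ (by norm_num) hs]; norm_num; linarith
  · rw [inv_lt_comm₀ hs (by norm_num)]; norm_num; linarith

/-- Bounds for `cos θ`, `sin θ` for `|θ| ≤ 1/10`. [folklore] -/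
theorem trig_bounds {θ : ℝ} (hθ : |θ| ≤ δ₀) : 99 / 100 ≤ Real.cos θ ∧ Real.cos θ ≤ 1 ∧ |Real.sin θ| ≤ 1 / 10 := by
  norm_num [δ₀] at hθ
  refine ⟨?_, Real.cos_le_one θ, (Real.abs_sin_le_abs).trans (by linarith)⟩
  have h := Real.one_sub_sq_div_two_le_cos (x := θ)
  have : θ ^ 2 ≤ 1 / 100 := by
    have := abs_le.1 hθ; nlinarith
  linarith

/-- `|a b| ≤ A B` from `|a| ≤ A`, `|b| ≤ B`. [folklore] -/
theorem abs_mul_le_of_le {a b A B : ℝ} (ha : |a| ≤ A) (hb : |b| ≤ B) (hA : 0 ≤ A) : |a * b| ≤ A * B := by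
  rw [abs_mul]; exact mul_le_mul ha hb (abs_nonneg _) hA

/-- The entries of `ñ(x) a(√y) k(θ)`. [folklore] -/
theorem iwasawaGinv_apply (x y θ : ℝ) :
    iwasawaGinv x y θ = !![Real.sqrt y * Real.cos θ - x * Real.sin θ * (Real.sqrt y)⁻¹,
      Real.sqrt y * Real.sin θ + x * Real.cos θ * (Real.sqrt y)⁻¹;
      -(Real.sin θ * (Real.sqrt y)⁻¹), Real.cos θ * (Real.sqrt y)⁻¹] := by
  ext i j
  fin_cases i <;> fin_cases j <;>
    simp [iwasawaGinv, upperShear, diagTorus, rotR, Matrix.mul_apply, Fin.sum_univ_two] <;> ring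

/-- **Entries of `g ∈ G₀`**: `|g₀₀ − 1|, |g₁₁ − 1|, |g₀₁|, |g₁₀| ≤ 1/4`. [folklore] -/
theorem entries_of_mem_G0 {g : Matrix (Fin 2) (Fin 2) ℝ} (hg : g ∈ G0) :
    |g 0 0 - 1| ≤ 1 / 4 ∧ |g 1 1 - 1| ≤ 1 / 4 ∧ |g 0 1| ≤ 1 / 4 ∧ |g 1 0| ≤ 1 / 4 := by
  obtain ⟨x, y, θ, hx, hy, hθ, rfl⟩ := mem_G0_iff.1 hg
  obtain ⟨hs1, hs2, hi1, hi2⟩ := sqrt_bounds hy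
  have hθ' : |θ| ≤ δ₀ := abs_le.2 ⟨hθ.1, hθ.2.le⟩
  obtain ⟨hc1, hc2, hsn⟩ := trig_bounds hθ'
  have hxle : |x| ≤ 1 / 10 := by norm_num [δ₀] at hx; exact hx.le
  have htabs : |(Real.sqrt y)⁻¹| ≤ 10 / 9 := by rw [abs_of_pos (by linarith)]; exact hi2.le
  have hsabs : |Real.sqrt y| ≤ 11 / 10 := by rw [abs_of_pos (by linarith)]; exact hs2.le
  have hcabs : |Real.cos θ| ≤ 1 := by rw [abs_of_pos (by linarith)]; exact hc2
  -- products
  have p1 : |x * Real.sin θ * (Real.sqrt y)⁻¹| ≤ 1 / 10 * (1 / 10) * (10 / 9) :=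
    abs_mul_le_of_le (abs_mul_le_of_le hxle hsn (by norm_num)) htabs (by norm_num)
  have p2 : |x * Real.cos θ * (Real.sqrt y)⁻¹| ≤ 1 / 10 * 1 * (10 / 9) :=
    abs_mul_le_of_le (abs_mul_le_of_le hxle hcabs (by norm_num)) htabs (by norm_num)
  have p3 : |Real.sqrt y * Real.sin θ| ≤ 11 / 10 * (1 / 10) := abs_mul_le_of_le hsabs hsn (by norm_num)
  have p4 : |Real.sin θ * (Real.sqrt y)⁻¹| ≤ 1 / 10 * (10 / 9) := abs_mul_le_of_le hsn htabs (by norm_num)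
  have q1 : |Real.sqrt y * Real.cos θ - 1| ≤ 11 / 100 := by
    rw [abs_le]; constructor <;> nlinarith
  have q2 : |Real.cos θ * (Real.sqrt y)⁻¹ - 1| ≤ 1 / 8 := by
    rw [abs_le]; constructor <;> nlinarith
  rw [iwasawaGinv_apply]
  simp only [Matrix.of_apply, Matrix.cons_val', Matrix.cons_val_zero, Matrix.cons_val_one,
    Matrix.cons_val_fin_one]
  refine ⟨?_, ?_, ?_, ?_⟩
  · calc |Real.sqrt y * Real.cos θ - x * Real.sin θ * (Real.sqrt y)⁻¹ - 1|
        = |(Real.sqrt y * Real.cos θ - 1) - x * Real.sin θ * (Real.sqrt y)⁻¹| := by ring_nf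
      _ ≤ |Real.sqrt y * Real.cos θ - 1| + |x * Real.sin θ * (Real.sqrt y)⁻¹| := abs_sub _ _
      _ ≤ 1 / 4 := by linarith
  · exact q2.trans (by norm_num)
  · calc |Real.sqrt y * Real.sin θ + x * Real.cos θ * (Real.sqrt y)⁻¹|
        ≤ |Real.sqrt y * Real.sin θ| + |x * Real.cos θ * (Real.sqrt y)⁻¹| := abs_add_le _ _
      _ ≤ 1 / 4 := by linarith
  · rw [abs_neg]; exact p4.trans (by norm_num)

/-! ## Products `h · adj(h')` of elements of `G₀` have positive diagonal -/

/-- For `h, h' ∈ G₀` the diagonal entries of `h h'⁻¹ = h · adj(h')` lie in `(1/2, ∞)`, hence its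
trace is positive and it is not `−1`. [folklore] -/
theorem diag_pos_of_mem_G0 {h h' : Matrix (Fin 2) (Fin 2) ℝ} (hh : h ∈ G0) (hh' : h' ∈ G0) :
    1 / 2 ≤ (h * h'.adjugate) 0 0 ∧ 1 / 2 ≤ (h * h'.adjugate) 1 1 := by
  obtain ⟨a1, d1, b1, c1⟩ := entries_of_mem_G0 hh
  obtain ⟨a2, d2, b2, c2⟩ := entries_of_mem_G0 hh'
  rw [Matrix.adjugate_fin_two]
  simp only [Matrix.mul_apply, Fin.sum_univ_two, Matrix.of_apply, Matrix.cons_val', Matrix.cons_val_zero,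
    Matrix.cons_val_one, Matrix.cons_val_fin_one]
  have ha1 := abs_le.1 a1; have hd1 := abs_le.1 d1; have hb1 := abs_le.1 b1; have hc1 := abs_le.1 c1
  have ha2 := abs_le.1 a2; have hd2 := abs_le.1 d2; have hb2 := abs_le.1 b2; have hc2 := abs_le.1 c2
  constructor <;> nlinarith

/-- The inverse of `h' ∈ G₀` is its adjugate (`det h' = 1`). [folklore] -/
theorem inv_eq_adjugate_of_mem_G0 {h' : Matrix (Fin 2) (Fin 2) ℝ} (hh' : h' ∈ G0) : h'⁻¹ = h'.adjugate := by
  rw [Matrix.inv_def, hh'.1, Ring.inverse_one, one_smul]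

/-! ## Stabilizers: `±1` or trace zero -/

/-- **Dichotomy for real stabilizers**: an element of the stabilizer of a form with `Δ ≠ 0` is
`±1` or has trace `0` (`BinaryQuarticStabilizer.trace_eq_zero_of_mem_stabilizerSet`). [folklore] -/
theorem scalar_or_trace_zero_of_mem_substStabilizer {P : BinaryQuartic ℝ} (hΔ : P.disc ≠ 0)
    {σ : Matrix (Fin 2) (Fin 2) ℝ} (hσ : σ ∈ substStabilizer P) :
    (σ = 1 ∨ σ = -1) ∨ σ 0 0 + σ 1 1 = 0 := by
  by_cases hsc : ∃ c : ℝ, σ = c • (1 : Matrix (Fin 2) (Fin 2) ℝ)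
  · obtain ⟨c, rfl⟩ := hsc
    left
    have h1 : P.subst (c • (1 : Matrix (Fin 2) (Fin 2) ℝ)) = P := hσ
    rw [subst_smul_matrix, subst_one] at h1
    have hc4 : c ^ 4 = 1 := eq_one_of_smul_eq hΔ h1
    have hc2 : c ^ 2 = 1 := by nlinarith [sq_nonneg (c ^ 2 + 1), sq_nonneg c]
    have hfac : (c - 1) * (c + 1) = 0 := by ring_nf; linarith
    rcases mul_eq_zero.1 hfac with h | h
    · left; rw [show c = 1 by linarith, one_smul]
    · right; rw [show c = -1 by linarith]; ext i j; fin_cases i <;> fin_cases j <;> simp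
  · right
    exact trace_eq_zero_of_mem_stabilizerSet two_ne_zero three_ne_zero hΔ
      (mem_stabilizerSet_of_mem_substStabilizer hΔ hσ) hsc

/-- The stabilizer is closed under inverses. [folklore] -/
theorem inv_mem_substStabilizer {P : BinaryQuartic ℝ} (hΔ : P.disc ≠ 0) {σ : Matrix (Fin 2) (Fin 2) ℝ}
    (hσ : σ ∈ substStabilizer P) : σ⁻¹ ∈ substStabilizer P := by
  have hdet : IsUnit σ.det := by
    have h := det_sq_eq_one_of_mem_substStabilizer hΔ hσ
    exact isUnit_iff_ne_zero.2 (by intro h0; rw [h0] at h; norm_num at h)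
  have h1 : P.subst σ = P := hσ
  show P.subst σ⁻¹ = P
  conv_lhs => rw [← h1]
  rw [← subst_mul, Matrix.nonsing_inv_mul _ hdet, subst_one]

/-- The stabilizer is closed under products. [folklore] -/
theorem mul_mem_substStabilizer {P : BinaryQuartic ℝ} {σ σ' : Matrix (Fin 2) (Fin 2) ℝ}
    (hσ : σ ∈ substStabilizer P) (hσ' : σ' ∈ substStabilizer P) : σ * σ' ∈ substStabilizer P := by
  have h1 : P.subst σ = P := hσ
  have h2 : P.subst σ' = P := hσ'
  show P.subst (σ * σ') = P
  rw [subst_mul, h2, h1]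

/-- **The core rigidity**: for `σ, σ'` in the stabilizer and `h, h' ∈ G₀`, `σ h = σ' h'` forces
`σ = σ'` (and `h = h'`): `σ'⁻¹σ = h' h⁻¹` is a stabilizer element with positive diagonal, so it is
`±1` with positive `(0,0)` entry, i.e. `1`. [folklore] -/
theorem eq_of_mul_eq_mul {P : BinaryQuartic ℝ} (hΔ : P.disc ≠ 0) {σ σ' h h' : Matrix (Fin 2) (Fin 2) ℝ}
    (hσ : σ ∈ substStabilizer P) (hσ' : σ' ∈ substStabilizer P) (hh : h ∈ G0) (hh' : h' ∈ G0)
    (heq : σ * h = σ' * h') : σ = σ' ∧ h = h' := by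
  have hdσ' : IsUnit σ'.det := isUnit_iff_ne_zero.2 (det_ne_zero_of_mem_substStabilizer hΔ hσ')
  have hdh : IsUnit h.det := by rw [hh.1]; exact isUnit_one
  -- `ρ := σ'⁻¹ σ = h' h⁻¹`
  set ρ : Matrix (Fin 2) (Fin 2) ℝ := σ'⁻¹ * σ with hρ
  have hρstab : ρ ∈ substStabilizer P := mul_mem_substStabilizer (inv_mem_substStabilizer hΔ hσ') hσ
  have hρeq : ρ = h' * h.adjugate := by
    have e1 : ρ * h = h' := by
      rw [hρ, Matrix.mul_assoc, heq, ← Matrix.mul_assoc, Matrix.nonsing_inv_mul _ hdσ', Matrix.one_mul]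
    rw [← inv_eq_adjugate_of_mem_G0 hh, ← e1, Matrix.mul_nonsing_inv_cancel_right _ _ hdh]
  obtain ⟨hd0, hd1⟩ := diag_pos_of_mem_G0 hh' hh
  rw [← hρeq] at hd0 hd1
  have hρ1 : ρ = 1 := by
    rcases scalar_or_trace_zero_of_mem_substStabilizer hΔ hρstab with (h1 | h1) | h1
    · exact h1
    · exfalso; rw [h1] at hd0; simp at hd0; linarith
    · exfalso; linarith
  have hσσ : σ = σ' := by
    have : σ' * ρ = σ := by rw [hρ, ← Matrix.mul_assoc, Matrix.mul_nonsing_inv _ hdσ', Matrix.one_mul]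
    rw [← this, hρ1, Matrix.mul_one]
  refine ⟨hσσ, ?_⟩
  rw [hσσ] at heq
  have := congrArg (fun M => σ'⁻¹ * M) heq
  simpa only [← Matrix.mul_assoc, Matrix.nonsing_inv_mul _ hdσ', Matrix.one_mul] using this

/-! ## The structure of `E(x₀) = {h : h⁻¹ · x₀ ∈ G₀⁻¹ · 𝓛}` -/

/-- The averaging region `B(𝓛) = {h'⁻¹ · ℓ : h' ∈ G₀, ℓ ∈ 𝓛} ⊂ V_ℝ` attached to a set `𝓛` of forms
(`ℓ ↦ h'⁻¹ · ℓ = ℓ ∘ h'⁻¹`). [cite: BhargavaShankarAnnals2015, §2.3 (the sets G₀L and B(n,t,λ,X); arXiv:1006.1002v2 numbering)] -/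
def avgSet (𝓛 : Set (BinaryQuartic ℝ)) : Set (BinaryQuartic ℝ) :=
  {v | ∃ h' ∈ G0, ∃ ℓ ∈ 𝓛, v = ℓ.subst h'⁻¹}

/-- Invariants are preserved by matrices of determinant `±1`. [folklore] -/
theorem I_subst_of_det {f : BinaryQuartic ℝ} {γ : Matrix (Fin 2) (Fin 2) ℝ} (hγ : γ.det = 1 ∨ γ.det = -1) :
    (f.subst γ).I = f.I := by
  rw [I_subst]
  rcases hγ with h | h
  · simp [h]
  · simp [h]; norm_num

/-- Invariants are preserved by matrices of determinant `±1`. [folklore] -/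
theorem J_subst_of_det {f : BinaryQuartic ℝ} {γ : Matrix (Fin 2) (Fin 2) ℝ} (hγ : γ.det = 1 ∨ γ.det = -1) :
    (f.subst γ).J = f.J := by
  rw [J_subst]
  rcases hγ with h | h
  · simp [h]
  · simp [h]; norm_num

/-- `det γ⁻¹ = ±1` for `det γ = ±1`. [folklore] -/
theorem det_inv_of_det {γ : Matrix (Fin 2) (Fin 2) ℝ} (hγ : γ.det = 1 ∨ γ.det = -1) :
    γ⁻¹.det = 1 ∨ γ⁻¹.det = -1 := by
  rw [Matrix.det_nonsing_inv]; rcases hγ with h | h <;> simp [h]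

/-- Products of matrices of determinant `±1` have determinant `±1`. [folklore] -/
theorem det_mul_of_det {γ γ' : Matrix (Fin 2) (Fin 2) ℝ} (hγ : γ.det = 1 ∨ γ.det = -1)
    (hγ' : γ'.det = 1 ∨ γ'.det = -1) : (γ * γ').det = 1 ∨ (γ * γ').det = -1 := by
  rw [Matrix.det_mul]; rcases hγ with h | h <;> rcases hγ' with h' | h' <;> simp [h, h']

/-- **Structure of `E(x₀)`** (Bhargava–Shankar §2.3: "there exist a finite number of elements
`g₁, …, g_n ∈ G_ℝ` satisfying `g_j x_L = x`", and `∫_{h ∈ G₀} #{g : x = g h x_L} dh =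
∑_j ∫_{G₀ ∩ F⁻¹g_j} dh`): if `𝓛` contains at most one form with given invariants, `ℓ₀ ∈ 𝓛` has
`Δ ≠ 0` and `x₀ = g₀ · ℓ₀` (`det g₀ = ±1`), then for `det h = ±1`:
`h⁻¹ · x₀ ∈ B(𝓛) ↔ h = g₀ σ h'` for some `σ ∈ Stab(ℓ₀)`, `h' ∈ G₀`. [cite: BhargavaShankarAnnals2015, §2.3 (eqs. (6)–(7); arXiv:1006.1002v2 numbering)] -/
theorem subst_inv_mem_avgSet_iff {𝓛 : Set (BinaryQuartic ℝ)}
    (hU : ∀ ℓ ∈ 𝓛, ∀ ℓ' ∈ 𝓛, ℓ.I = ℓ'.I → ℓ.J = ℓ'.J → ℓ = ℓ')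
    {ℓ₀ : BinaryQuartic ℝ} (hℓ₀ : ℓ₀ ∈ 𝓛) (hΔ : ℓ₀.disc ≠ 0)
    {g₀ : Matrix (Fin 2) (Fin 2) ℝ} (hg₀ : g₀.det = 1 ∨ g₀.det = -1)
    {h : Matrix (Fin 2) (Fin 2) ℝ} (hh : h.det = 1 ∨ h.det = -1) :
    (ℓ₀.subst g₀).subst h⁻¹ ∈ avgSet 𝓛 ↔
      ∃ σ ∈ substStabilizer ℓ₀, ∃ h' ∈ G0, h = g₀ * σ * h' := by
  have hdh : IsUnit h.det := isUnit_iff_ne_zero.2 (by rcases hh with e | e <;> rw [e] <;> norm_num)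
  have hdg : IsUnit g₀.det := isUnit_iff_ne_zero.2 (by rcases hg₀ with e | e <;> rw [e] <;> norm_num)
  constructor
  · rintro ⟨h', hh', ℓ, hℓ, heq⟩
    have hdh' : IsUnit h'.det := by rw [hh'.1]; exact isUnit_one
    rw [← subst_mul] at heq
    -- `ℓ = ℓ₀` by invariants
    have hdet1 : (h⁻¹ * g₀).det = 1 ∨ (h⁻¹ * g₀).det = -1 := det_mul_of_det (det_inv_of_det hh) hg₀
    have hdet2 : h'⁻¹.det = 1 ∨ h'⁻¹.det = -1 := det_inv_of_det (Or.inl hh'.1)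
    have hI : ℓ₀.I = ℓ.I := by
      have := congrArg BinaryQuartic.I heq
      rwa [I_subst_of_det hdet1, I_subst_of_det hdet2] at this
    have hJ : ℓ₀.J = ℓ.J := by
      have := congrArg BinaryQuartic.J heq
      rwa [J_subst_of_det hdet1, J_subst_of_det hdet2] at this
    have hℓℓ : ℓ = ℓ₀ := (hU ℓ₀ hℓ₀ ℓ hℓ hI hJ).symm
    subst hℓℓ
    -- `σ̃ := h' h⁻¹ g₀ ∈ Stab(ℓ)`
    have hstab : h' * (h⁻¹ * g₀) ∈ substStabilizer ℓ := by
      show ℓ.subst (h' * (h⁻¹ * g₀)) = ℓ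
      rw [subst_mul, heq, ← subst_mul, Matrix.mul_nonsing_inv _ hdh', subst_one]
    refine ⟨(h' * (h⁻¹ * g₀))⁻¹, inv_mem_substStabilizer hΔ hstab, h', hh', ?_⟩
    rw [Matrix.mul_inv_rev, Matrix.mul_inv_rev, Matrix.nonsing_inv_nonsing_inv _ hdh]
    simp only [Matrix.mul_assoc]
    rw [Matrix.nonsing_inv_mul _ hdh', Matrix.mul_one, ← Matrix.mul_assoc, Matrix.mul_nonsing_inv _ hdg,
      Matrix.one_mul]
  · rintro ⟨σ, hσ, h', hh', rfl⟩
    have hdh' : IsUnit h'.det := by rw [hh'.1]; exact isUnit_one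
    have hdσ : IsUnit σ.det := isUnit_iff_ne_zero.2 (det_ne_zero_of_mem_substStabilizer hΔ hσ)
    refine ⟨h', hh', ℓ₀, hℓ₀, ?_⟩
    have hσinv : ℓ₀.subst σ⁻¹ = ℓ₀ := inv_mem_substStabilizer hΔ hσ
    rw [Matrix.mul_inv_rev, Matrix.mul_inv_rev, ← subst_mul]
    simp only [Matrix.mul_assoc]
    rw [Matrix.nonsing_inv_mul _ hdg, Matrix.mul_one, subst_mul, hσinv]

/-! ## The measure of `E(x₀)`: `|Stab(ℓ₀)| · μ(G₀)` -/

section Measure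

variable [MeasurableSpace (Matrix (Fin 2) (Fin 2) ℝ)] [BorelSpace (Matrix (Fin 2) (Fin 2) ℝ)]

/-- `G₀` is measurable. [folklore] -/
theorem measurableSet_G0 : MeasurableSet G0 :=
  measurableSet_coordSet measurableSet_rect0 (measurableSet_arc (by have := Real.pi_gt_three; norm_num [δ₀]; linarith))

/-- A left translate of `G₀` by a matrix of determinant `±1` has the same Haar measure. [folklore] -/
theorem haarSL2pm_image_mul_left {g : Matrix (Fin 2) (Fin 2) ℝ} (hg : g.det = 1 ∨ g.det = -1) :
    haarSL2pm ((fun h' => g * h') '' G0) = haarSL2pm G0 := by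
  have hdg : IsUnit g.det := isUnit_iff_ne_zero.2 (by rcases hg with e | e <;> rw [e] <;> norm_num)
  have e : (fun h' => g * h') '' G0 = (fun h => g⁻¹ * h) ⁻¹' G0 := by
    ext h
    constructor
    · rintro ⟨h', hh', rfl⟩
      simp only [Set.mem_preimage]
      rwa [Matrix.nonsing_inv_mul_cancel_left _ _ hdg]
    · intro hh
      exact ⟨g⁻¹ * h, hh, by show g * (g⁻¹ * h) = h; rw [Matrix.mul_nonsing_inv_cancel_left _ _ hdg]⟩
  rw [e, haarSL2pm_preimage_mul_left (det_inv_of_det hg) measurableSet_G0]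

/-- Left translates of `G₀` are measurable. [folklore] -/
theorem measurableSet_image_mul_left {g : Matrix (Fin 2) (Fin 2) ℝ} (hg : g.det = 1 ∨ g.det = -1) :
    MeasurableSet ((fun h' => g * h') '' G0) := by
  have hdg : IsUnit g.det := isUnit_iff_ne_zero.2 (by rcases hg with e | e <;> rw [e] <;> norm_num)
  have e : (fun h' => g * h') '' G0 = (fun h => g⁻¹ * h) ⁻¹' G0 := by
    ext h
    constructor
    · rintro ⟨h', hh', rfl⟩
      simp only [Set.mem_preimage]
      rwa [Matrix.nonsing_inv_mul_cancel_left _ _ hdg]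
    · intro hh
      exact ⟨g⁻¹ * h, hh, by show g * (g⁻¹ * h) = h; rw [Matrix.mul_nonsing_inv_cancel_left _ _ hdg]⟩
  rw [e]
  exact measurable_mul_left _ measurableSet_G0

/-- **`μ(E(x₀)) = |Stab(ℓ₀)| · μ(G₀)`**: the translates `g₀ σ G₀`, `σ ∈ Stab(ℓ₀)`, are pairwise
disjoint and each has measure `μ(G₀)` (left invariance). [cite: BhargavaShankarAnnals2015, §2.3 (eq. (7): Σ_j ∫_{G₀ ∩ F⁻¹ g_j} dh; arXiv:1006.1002v2 numbering)] -/
theorem haarSL2pm_biUnion_translates {P : BinaryQuartic ℝ} (hΔ : P.disc ≠ 0)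
    {g₀ : Matrix (Fin 2) (Fin 2) ℝ} (hg₀ : g₀.det = 1 ∨ g₀.det = -1)
    (S : Finset (Matrix (Fin 2) (Fin 2) ℝ)) (hS : ∀ σ ∈ S, σ ∈ substStabilizer P) :
    haarSL2pm (⋃ σ ∈ S, (fun h' => g₀ * σ * h') '' G0) = S.card * haarSL2pm G0 := by
  have hdetσ : ∀ σ ∈ S, σ.det = 1 ∨ σ.det = -1 := fun σ hσ => by
    have h2 := det_sq_eq_one_of_mem_substStabilizer hΔ (hS σ hσ)
    have hfac : (σ.det - 1) * (σ.det + 1) = 0 := by ring_nf; linarith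
    rcases mul_eq_zero.1 hfac with h | h
    · left; linarith
    · right; linarith
  rw [measure_biUnion_finset]
  · rw [Finset.sum_congr rfl fun σ hσ => haarSL2pm_image_mul_left (det_mul_of_det hg₀ (hdetσ σ hσ)),
      Finset.sum_const, nsmul_eq_mul]
  · intro σ hσ σ' hσ' hne
    rw [Function.onFun, Set.disjoint_left]
    rintro _ ⟨h, hh, rfl⟩ ⟨h', hh', heq⟩
    have hdg : IsUnit g₀.det := isUnit_iff_ne_zero.2 (by rcases hg₀ with e | e <;> rw [e] <;> norm_num)
    have heq' : σ' * h' = σ * h := by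
      have := congrArg (fun M => g₀⁻¹ * M) heq
      simpa only [← Matrix.mul_assoc, Matrix.nonsing_inv_mul _ hdg, Matrix.one_mul] using this
    exact hne ((eq_of_mul_eq_mul hΔ (hS σ' hσ') (hS σ hσ) hh' hh heq').1).symm
  · intro σ hσ
    exact measurableSet_image_mul_left (det_mul_of_det hg₀ (hdetσ σ hσ))

omit [MeasurableSpace (Matrix (Fin 2) (Fin 2) ℝ)] [BorelSpace (Matrix (Fin 2) (Fin 2) ℝ)] in
/-- **The hyperbolic area of the rectangle**: `vol_ℍ(rect0) = 2δ₀ · (1/(1−δ₀) − 1/(1+δ₀))`.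
[folklore] -/
theorem volume_coe_preimage_rect0 :
    volume (((↑) : ℍ → ℂ) ⁻¹' rect0) = ENNReal.ofReal (2 * δ₀ * (1 / (1 - δ₀) - 1 / (1 + δ₀))) := by
  rw [volume_coe_preimage measurableSet_rect0 rect0_subset]
  have hmp := Complex.volume_preserving_equiv_real_prod.symm
  rw [← hmp.setLIntegral_comp_preimage_emb Complex.measurableEquivRealProd.symm.measurableEmbedding]
  have hpre : Complex.measurableEquivRealProd.symm ⁻¹' rect0 =
      Set.Ioo (-δ₀) δ₀ ×ˢ Set.Ioo (1 - δ₀) (1 + δ₀) := by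
    ext p
    simp only [rect0, Set.mem_preimage, Set.mem_setOf_eq, Set.mem_prod, Set.mem_Ioo,
      Complex.measurableEquivRealProd_symm_apply, abs_lt]
    constructor
    · rintro ⟨⟨h1, h2⟩, h3, h4⟩; exact ⟨⟨h1, h2⟩, by linarith, by linarith⟩
    · rintro ⟨⟨h1, h2⟩, h3, h4⟩; exact ⟨⟨h1, h2⟩, by linarith, by linarith⟩
  rw [hpre]
  have hfg : (fun a : ℝ × ℝ => ENNReal.ofReal (1 / (Complex.measurableEquivRealProd.symm a).im ^ 2)) =
      fun p => ENNReal.ofReal (1 / p.2 ^ 2) := by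
    funext p; simp [Complex.measurableEquivRealProd_symm_apply]
  rw [hfg, Measure.volume_eq_prod, ← Measure.prod_restrict,
    lintegral_prod _ (by fun_prop : Measurable fun p : ℝ × ℝ => ENNReal.ofReal (1 / p.2 ^ 2)).aemeasurable]
  simp only
  rw [lintegral_const, Measure.restrict_apply MeasurableSet.univ, Set.univ_inter, Real.volume_Ioo]
  have hδ : (0 : ℝ) < 1 - δ₀ := by norm_num [δ₀]
  have hint : ∫⁻ y in Set.Ioo (1 - δ₀) (1 + δ₀), ENNReal.ofReal (1 / y ^ 2) =
      ENNReal.ofReal (1 / (1 - δ₀) - 1 / (1 + δ₀)) := by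
    have hcont : ContinuousOn (fun y : ℝ => 1 / y ^ 2) (Set.Icc (1 - δ₀) (1 + δ₀)) := by
      apply ContinuousOn.div continuousOn_const (by fun_prop)
      intro y hy
      have : 0 < y := by linarith [hy.1, hδ]
      positivity
    rw [setLIntegral_congr (Ioo_ae_eq_Icc (a := 1 - δ₀) (b := 1 + δ₀)),
      ← ofReal_integral_eq_lintegral_ofReal (hcont.integrableOn_Icc) ?_]
    · congr 1
      rw [integral_Icc_eq_integral_Ioc, ← intervalIntegral.integral_of_le (by norm_num [δ₀])]
      rw [intervalIntegral.integral_eq_sub_of_hasDerivAt (f := fun y : ℝ => -y⁻¹)]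
      · simp only [one_div]; ring
      · intro y hy
        rw [Set.uIcc_of_le (by norm_num [δ₀])] at hy
        have hy0 : y ≠ 0 := by have := hy.1; norm_num [δ₀] at this; linarith
        have h := (hasDerivAt_inv hy0).neg
        refine h.congr_deriv ?_
        field_simp
      · exact hcont.intervalIntegrable_of_Icc (by norm_num [δ₀])
    · filter_upwards [ae_restrict_mem measurableSet_Icc] with y hy
      positivity
  rw [hint, ← ENNReal.ofReal_mul (by norm_num [δ₀])]
  congr 1
  ring

/-- **`μ(G₀) = vol_ℍ(rect0) · 2δ₀`**, explicitly. [folklore] -/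
theorem haarSL2pm_G0 :
    haarSL2pm G0 = ENNReal.ofReal (2 * δ₀ * (1 / (1 - δ₀) - 1 / (1 + δ₀))) * ENNReal.ofReal (2 * δ₀) := by
  rw [G0, haarSL2pm_coordSet measurableSet_rect0 (measurableSet_arc (by have := Real.pi_gt_three; norm_num [δ₀]; linarith)),
    volume_coe_preimage_rect0, volume_arc (by have := Real.pi_gt_three; norm_num [δ₀]; linarith)]
  congr 2; ring

/-- `μ(G₀)` as a real number. [folklore] -/
theorem haarSL2pm_G0_toReal :
    (haarSL2pm G0).toReal = 2 * δ₀ * (1 / (1 - δ₀) - 1 / (1 + δ₀)) * (2 * δ₀) := by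
  rw [haarSL2pm_G0, ENNReal.toReal_mul, ENNReal.toReal_ofReal (by norm_num [δ₀]),
    ENNReal.toReal_ofReal (by norm_num [δ₀])]

/-- `μ(G₀) > 0`. [folklore] -/
theorem haarSL2pm_G0_pos : 0 < haarSL2pm G0 := by
  rw [haarSL2pm_G0]
  exact ENNReal.mul_pos (fun h => by rw [ENNReal.ofReal_eq_zero] at h; norm_num [δ₀] at h)
    (fun h => by rw [ENNReal.ofReal_eq_zero] at h; norm_num [δ₀] at h)

/-- `μ(G₀) < ∞`. [folklore] -/
theorem haarSL2pm_G0_ne_top : haarSL2pm G0 ≠ ⊤ := by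
  rw [haarSL2pm_G0]; exact ENNReal.mul_ne_top ENNReal.ofReal_ne_top ENNReal.ofReal_ne_top

end Measure

end BinaryQuartic

end Literature.NumberTheory.EllipticCurves

end
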